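import Summits.ResolutionOfSingularities.ResolutionOfSingularities.Theorems.HilbertSamuelEliminationSigmaMaxModificationsCorridor3WLadderMovingTwoLoc
import Summits.ResolutionOfSingularities.ResolutionOfSingularities.Theorems.HilbertSamuelEliminationSigmaMaxModificationsCorridor3WLadderStrataStrictTransform
import Summits.ResolutionOfSingularities.ResolutionOfSingularities.Theorems.HilbertSamuelEliminationSigmaMaxModificationsCorridor3Directrix214SharpNearFibre
import Literature.AlgebraicGeometry.CossartJannsenSaito2020.ProjDirLine
import Literature.AlgebraicGeometry.Resolution.ExcellentBlowup
import Literature.RingTheory.HilbertSamuel.HironakaGrothendieckIsomorphism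
import Summits.ResolutionOfSingularities.ResolutionOfSingularities.Theorems.HilbertSamuelEliminationSigmaMaxModificationsCorridor3WLadderStrataCentreCurveDominantCleanGeomDir
import Summits.ResolutionOfSingularities.ResolutionOfSingularities.Theorems.HilbertSamuelEliminationSigmaMaxModificationsCorridor3WLadderStrataCentreDispatchGeomDir
import Summits.ResolutionOfSingularities.ResolutionOfSingularities.Theorems.HilbertSamuelEliminationSigmaMaxModificationsCorridor3WLadderStrataCentrePointGermGeomDir
import Literature.AlgebraicGeometry.CossartJannsenSaito2020.DirectrixSemicontinuityProof
import Literature.AlgebraicGeometry.CossartJannsenSaito2020.DirectrixGenerizationHolds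
import Literature.AlgebraicGeometry.CossartJannsenSaito2020.ProjDirProjectiveLineRegular
import Summits.ResolutionOfSingularities.ResolutionOfSingularities.Theorems.HilbertSamuelEliminationSigmaMaxModificationsCorridor3Theorem314PointLocusOfThmIV
import Literature.AlgebraicGeometry.CossartJannsenSaito2020.KeyTheoremsLocalLinks
import Literature.AlgebraicGeometry.Resolution.OneDimensionalBlowupTowerProof
import HarnessLib

/-!
# [OURS · L1 W4.2] Row `stub_Wlow3M_two` (crux chain w42, line `w_ladder`): ONE-STATEMENT CENSUS, second edition — the
# (F1♯) shadows `Theorem314_geomDir` / `Theorem314_nearFibre_geomDir` and CJS Thm. 3.14 DISCHARGED, (K-str) closed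

Stub worker res-L1-w42-stub-3 (gen 4); crux `SigmaMaxModifications` stmt-ResolutionOfSingularities-18506, conjunct
`SigmaMaxModificationsCorridor3` stmt-ResolutionOfSingularities-19249, registered stub
`WLadder.stub_Wlow3M_two : ∀ p, p.Prime → Moving.Wlow3TwoM p` (skeleton `w_ladder` v7/v8.1). OURS (cell res-hironaka, slot
W4.2); NOT statements of H. Hironaka's manuscript [Hironaka2017] nor of [CossartJannsenSaito2020]; AI-written, weaker than
expert review. Helper file `--supports stmt-ResolutionOfSingularities-19249`.

Compared with the first census `wlow3TwoM_census` (p520092; premises PRINTED {CJS 3.10 (4), `Thm314_point_locus`,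
`ProjDir_line`, F14 [H4] Th. IV point, F15 [H5], F16 Mizutani} + OURS R_β {`KeyTheorem640_localized_isolated`,
`Corollary637_geomDir`} + (F1♯) SHADOWS {`Theorem314_geomDir`, `Theorem314_nearFibre_geomDir`} + CONSTRUCTIONS
{`Seg.UnitRecognitionAtQM 2 ⊤`, (c-geo), (c-reg)}), this edition plugs in, BY NAME:

* both (F1♯) shadows — `Directrix214Sharp.theorem314_geomDir_of_thmIV_of_split` and
  `Directrix214Sharp.theorem314_nearFibre_geomDir_of_facts` (this seat, `…Corridor3Directrix214SharpNearFibre`), from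
  F-51′ `Hironaka1970_thmIV` + F-split `HerrmannIkedaOrbanz1988_cor_21_11`;
* `Thm314_point_locus` — no longer a premise (`Directrix214Sharp.thm314_point_locus_geomDir_of_thmIV_point`, every
  characteristic, from F-51 = F-51′ at a point);
* `ProjDir_line` — PROVED (`projDir_line`, res-type-031); F15 — PROVED (`Hironaka1970_thm1_cor_holds`); F16 — PROVED
  (`mizutani1973_vectorGroup_of_dim_le_of_hironaka`);
* (c-reg) ⟸ (K-ctr) `StrataCentreMembersClean` (stub-4: `strataCycleStartRegular_of_centreMembersClean`, (K-str) closed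
  outright p519120/`strataStrictTransformClean_holds`).

RESULT `wlow3TwoM_census₂`: `∀ p, p.Prime → Wlow3TwoM p` ⟸ PRINTED {F-51′ `Hironaka1970_thmIV`, F-split
`HerrmannIkedaOrbanz1988_cor_21_11`, CJS Thm. 3.10 (4) `CossartJannsenSaito2020_thm_3_10_4`} + OURS CLAIMS R_β
{`KeyTheorem640_localized_isolated`, `Corollary637_geomDir`} + OURS CONSTRUCTIONS {`Seg.UnitRecognitionAtQM 2 ⊤` (stub-1),
(c-geo) `StrataLineageInCentreIO`, (K-ctr) `StrataCentreMembersClean` (stub-4 / res-D-pv-038)} — CONDITIONAL, credits nothing;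
it is the row's honest residue as ONE checkable statement. By-products for the neighbouring rows: `thm_3_14_of_theorem314_geomDir`
and `cossartJannsenSaito2020_thm_3_14_of_thmIV_of_split` (the printed CJS Thm. 3.14, numerical rendering, is a THEOREM modulo
F-51′ + F-split), `wlow3CharStrataM_of_thmIV_split_centreIO_centreMembersClean` (the strata half of the characteristic row
`stub_Wlow3M_char` from F-51′ + F-split + (c-geo) + (K-ctr)).

References: CJS LNM 2270 Thm. 3.10 (4), Thm. 3.14, Def. 6.34, Thm. 6.35, Cor. 6.37, Def. 6.38/6.39, Thm. 6.40
[CossartJannsenSaito2020]; H. Hironaka, J. Math. Kyoto Univ. 10 (1970) Th. IV [Hironaka1970NumericalCharacters]; M. Herrmann,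
S. Ikeda, U. Orbanz (1988) Cor. (21.11) [HerrmannIkedaOrbanz1988]; CHAIN v3.14 (CG).
-/

noncomputable section

-- namespace `…Corridor3.Moving` re-enters `…Corridor3` (module convention of the Moving files)
set_option linter.dupNamespace false

open CategoryTheory AlgebraicGeometry TopologicalSpace IsLocalRing
open Literature.AlgebraicGeometry.Resolution Literature.AlgebraicGeometry.Resolution.HironakaScheme
open Literature.RingTheory.HilbertSamuel
open Summit.ResolutionOfSingularities.ResolutionOfSingularities.Theorems.CampaignW42
open Literature.AlgebraicGeometry.CossartJannsenSaito2020
open Summit.ResolutionOfSingularities.ResolutionOfSingularities.Theses.HilbertSamuelElimination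
open Summit.ResolutionOfSingularities.ResolutionOfSingularities.Theorems.SigmaMaxModificationsCorridor3

namespace Summit.ResolutionOfSingularities.ResolutionOfSingularities.Theorems.SigmaMaxModificationsCorridor3.Moving

universe u

/-! ## CJS Thm. 3.14 (numerical rendering) as a theorem modulo F-51′ + F-split -/

/-- **(F1♯) ⇒ (F1) for the numerical rendering**: the binder `Theorem314_geomDir` implies the printed named fact
`CossartJannsenSaito2020_thm_3_14` (`CharHypothesis ⇒ GeomDirHypothesis`, `geomDirHypothesis_of_charHypothesis`; the blow-up
of a locally noetherian scheme is locally noetherian, `IsBlowup.isLocallyNoetherian'`). [cite: CossartJannsenSaito2020, Thm. 3.14, Def. 2.21] -/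
theorem thm_3_14_of_theorem314_geomDir (hF : Theorem314_geomDir.{u}) : CossartJannsenSaito2020_thm_3_14.{u} := by
  intro X X' _ π D hexc hperm hπ N hdim x' hxD hchar hnear
  haveI : IsLocallyNoetherian X' := hπ.isLocallyNoetherian'
  exact hF X X' π D N x' (π.base x') hexc hperm hπ hdim rfl hxD (geomDirHypothesis_of_charHypothesis hchar) hnear

/-- **The printed CJS Thm. 3.14 (numerical rendering `dim 𝒪_{D,x} < e_x(X)` at a near point) is a THEOREM modulo F-51′
`Hironaka1970_thmIV` + F-split `HerrmannIkedaOrbanz1988_cor_21_11`** (through this seat's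
`Directrix214Sharp.theorem314_geomDir_of_thmIV_of_split`). [OURS · L1 W4.2; AI-written]
[cite: CossartJannsenSaito2020, Thm. 3.14; Hironaka1970NumericalCharacters, Th. IV; HerrmannIkedaOrbanz1988, Cor. (21.11)] -/
theorem cossartJannsenSaito2020_thm_3_14_of_thmIV_of_split (h51 : Hironaka1970_thmIV.{u})
    (hsplit : HerrmannIkedaOrbanz1988_cor_21_11.{u}) : CossartJannsenSaito2020_thm_3_14.{u} :=
  thm_3_14_of_theorem314_geomDir (Directrix214Sharp.theorem314_geomDir_of_thmIV_of_split h51 hsplit)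

/-! ## The census, second edition -/

/-- **THE CHARACTERISTIC-2 ROW `stub_Wlow3M_two`: ONE-STATEMENT CENSUS, second edition (2026-08-27, gen 4).** The registered
stub `∀ p, p.Prime → Wlow3TwoM p` follows from: PRINTED — [H4] Th. IV `Hironaka1970_thmIV` (F-51′), the Hironaka–Grothendieck
isomorphism `HerrmannIkedaOrbanz1988_cor_21_11` (F-split), CJS Thm. 3.10 (4) `CossartJannsenSaito2020_thm_3_10_4`; OURS CLAIMS
(R_β) — `KeyTheorem640_localized_isolated`, `Corollary637_geomDir`; OURS CONSTRUCTIONS — unit recognition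
`Seg.UnitRecognitionAtQM 2 ⊤`, (c-geo) `StrataLineageInCentreIO`, (K-ctr) `StrataCentreMembersClean` (at `p = 2`, level `3`,
origins `QNe ⊤`, grade `ē ≤ 2`). The (F1♯) shadows, `Thm314_point_locus`, `ProjDir_line`, F14–F16 and (K-str) of the first
edition are PLUGGED BY NAME (module docstring). CONDITIONAL — credits nothing; the row's honest residue as ONE checkable
statement. [cite: CossartJannsenSaito2020, Thm. 3.10 (4), Thm. 3.14, Def. 6.34, Thm. 6.35, Cor. 6.37, Def. 6.38, Thm. 6.40] -/
theorem wlow3TwoM_census₂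
    (h51 : Hironaka1970_thmIV.{0}) (hsplit : HerrmannIkedaOrbanz1988_cor_21_11.{0})
    (h3104 : CossartJannsenSaito2020_thm_3_10_4.{0})
    (hK : KeyTheorem640_localized_isolated.{0}) (hC : Corollary637_geomDir.{0})
    (hrec : Seg.UnitRecognitionAtQM 2 fun _ _ _ _ => True)
    (hgeo : StrataLineageInCentreIO.{0} 2 3 (QNe fun _ _ _ _ => True) fun s => s.geomDirDim ≤ 2)
    (hKctr : StrataCentreMembersClean.{0} 2 3 (QNe fun _ _ _ _ => True) fun s => s.geomDirDim ≤ 2) :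
    ∀ p : ℕ, p.Prime → Wlow3TwoM.{0} p :=
  wlow3TwoM_of_residue_loc hK hC (Directrix214Sharp.theorem314_geomDir_of_thmIV_of_split h51 hsplit)
    (isoE1BridgeFreeM_of_facts (Directrix214Sharp.theorem314_geomDir_of_thmIV_of_split h51 hsplit) h3104
      (Directrix214Sharp.thm314_point_locus_geomDir_of_thmIV_point (Hironaka1970_thmIV_point_of_thmIV h51)) projDir_line 2)
    (unitTowerExtractionLocFreeM_of_recognition hrec)
    (wlowStrataM_of_geomDir_centreIO_cycleStartRegular (Directrix214Sharp.theorem314_geomDir_of_thmIV_of_split h51 hsplit)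
      (Directrix214Sharp.theorem314_nearFibre_geomDir_of_facts h51 hsplit) hgeo
      (strataCycleStartRegular_of_centreMembersClean hKctr))

/-! ## By-product for the characteristic row `stub_Wlow3M_char`: its strata half from F-51′ + F-split + (c-geo) + (K-ctr) -/

/-- **The (F1)-regime strata row `Wlow3CharStrataM p` from F-51′ + F-split (printed, BY NAME) and the two strata kernels
(c-geo), (K-ctr)** — stub-4's `wlow3CharStrataM_of_geomDir_centreIO_cycleStartRegular` with both (F1♯) binders discharged and
(c-reg) reduced to (K-ctr). [OURS · L1 W4.2; AI-written] [cite: CossartJannsenSaito2020, Thm. 3.14, Thm. 6.35, Rem. 6.29 (1)] -/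
theorem wlow3CharStrataM_of_thmIV_split_centreIO_centreMembersClean {p : ℕ} (h51 : Hironaka1970_thmIV.{0})
    (hsplit : HerrmannIkedaOrbanz1988_cor_21_11.{0})
    (hgeo : StrataLineageInCentreIO.{0} p 3 (QNe (Helpers.QCharRegime p)) fun s => s.geomDirDim ≤ 2)
    (hKctr : StrataCentreMembersClean.{0} p 3 (QNe (Helpers.QCharRegime p)) fun s => s.geomDirDim ≤ 2) :
    Wlow3CharStrataM p :=
  wlow3CharStrataM_of_geomDir_centreIO_cycleStartRegular (Directrix214Sharp.theorem314_geomDir_of_thmIV_of_split h51 hsplit)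
    (Directrix214Sharp.theorem314_nearFibre_geomDir_of_facts h51 hsplit) hgeo
    (strataCycleStartRegular_of_centreMembersClean hKctr)

/-- **The regime-free strata row `WlowStrataM p` (every prime, every origin) from F-51′ + F-split + (c-geo)⊤ + (K-ctr)⊤.**
[OURS · L1 W4.2; AI-written] [cite: CossartJannsenSaito2020, Thm. 3.14, Thm. 6.35, Rem. 6.29 (1)] -/
theorem wlowStrataM_of_thmIV_split_centreIO_centreMembersClean {p : ℕ} (h51 : Hironaka1970_thmIV.{0})
    (hsplit : HerrmannIkedaOrbanz1988_cor_21_11.{0})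
    (hgeo : StrataLineageInCentreIO.{0} p 3 (QNe fun _ _ _ _ => True) fun s => s.geomDirDim ≤ 2)
    (hKctr : StrataCentreMembersClean.{0} p 3 (QNe fun _ _ _ _ => True) fun s => s.geomDirDim ≤ 2) : WlowStrataM p :=
  wlowStrataM_of_geomDir_centreIO_cycleStartRegular (Directrix214Sharp.theorem314_geomDir_of_thmIV_of_split h51 hsplit)
    (Directrix214Sharp.theorem314_nearFibre_geomDir_of_facts h51 hsplit) hgeo
    (strataCycleStartRegular_of_centreMembersClean hKctr)

/-! ## (appended 2026-08-27, same seat) F-split is a THEOREM (`HerrmannIkedaOrbanz1988_cor_21_11_holds`, res-D-lib-1 p518484):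
## everything above modulo F-51′ `Hironaka1970_thmIV` ALONE — census, third edition -/

/-- **The (F1♯) near-fibre binder from F-51′ alone**: `Moving.Theorem314_nearFibre_geomDir ⟸ Hironaka1970_thmIV` (this seat's
`Directrix214Sharp.theorem314_nearFibre_geomDir_of_facts` with F-split supplied by the tree theorem
`HerrmannIkedaOrbanz1988_cor_21_11_holds`). [OURS · L1 W4.2; AI-written] [cite: CossartJannsenSaito2020, Thm. 3.14; Hironaka1970NumericalCharacters, Th. IV] -/
theorem theorem314_nearFibre_geomDir_of_thmIV (h51 : Hironaka1970_thmIV.{u}) : Theorem314_nearFibre_geomDir.{u} :=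
  Directrix214Sharp.theorem314_nearFibre_geomDir_of_facts h51 HerrmannIkedaOrbanz1988_cor_21_11_holds

/-- **The printed F-61 `Thm314_nearFibre_subsingleton` (CJS Thm. 3.14, near-fibre rendering) is a THEOREM modulo F-51′
`Hironaka1970_thmIV` alone.** [OURS · L1 W4.2; AI-written] [cite: CossartJannsenSaito2020, Thm. 3.14; Hironaka1970NumericalCharacters, Th. IV] -/
theorem thm314_nearFibre_subsingleton_of_thmIV (h51 : Hironaka1970_thmIV.{u}) : Thm314_nearFibre_subsingleton.{u} :=
  Directrix214Sharp.thm314_nearFibre_subsingleton_of_facts h51 HerrmannIkedaOrbanz1988_cor_21_11_holds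

/-- **Near-fibre subsingleton AND `k(x)`-rationality of the near point from F-51′ alone** (general permissible centre, `x ∈ D`
possibly non-closed, (F1♯) at `x`, `e_x(X) ≤ dim 𝒪_{D,x} + 1`). [OURS · L1 W4.2; AI-written]
[cite: CossartJannsenSaito2020, Thm. 3.14, p. 103 L32; Hironaka1970NumericalCharacters, Th. IV] -/
theorem nearFibre_subsingleton_and_isIso_of_thmIV (h51 : Hironaka1970_thmIV.{u})
    {X X' : Scheme.{u}} [IsLocallyNoetherian X] (π : X' ⟶ X) (D : X.IdealSheafData)
    (hexc : Scheme.IsExcellent X) (hperm : IdealSheafData.IsPermissible D) (hπ : IsBlowup π D)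
    (N : ℕ) (hdim : topologicalKrullDim X ≤ (N : WithBot ℕ∞))
    (x : X) (hxD : x ∈ D.support) (hgeo : GeomDirHypothesis X x)
    (he : (Scheme.dirDim X x : WithBot ℕ∞) ≤ ringKrullDim (X.presheaf.stalk x ⧸ stalkIdeal D x) + 1) :
    {x' : X' | π.base x' = x ∧ Scheme.hsFun X' N x' = Scheme.hsFun X N x}.Subsingleton ∧
      ∀ x' : X', π.base x' = x → Scheme.hsFun X' N x' = Scheme.hsFun X N x → IsIso (π.residueFieldMap x') :=
  Directrix214Sharp.theorem314_nearFibre_geomDir_and_isIso_of_facts h51 HerrmannIkedaOrbanz1988_cor_21_11_holds π D hexc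
    hperm hπ N hdim x hxD hgeo he

/-- **The binder (B4) of the (R2) consumer from F-51′ alone** (verbatim binder order of res-L1-s42-pv-1's
`CampaignW42.isIso_residueFieldMap_of_near_of_charHypothesis`). [OURS · L1 W4.2; AI-written]
[cite: CossartJannsenSaito2020, Thm. 3.14, Def. 6.34 (i), p. 104; Hironaka1970NumericalCharacters, Th. IV] -/
theorem isIso_residueFieldMap_of_near_B4_of_thmIV (h51 : Hironaka1970_thmIV.{u}) :
    ∀ (X X' : Scheme.{u}) [IsLocallyNoetherian X] [IsLocallyNoetherian X'] (π : X' ⟶ X) (D : X.IdealSheafData),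
      Scheme.IsExcellent X → IdealSheafData.IsPermissible D → IsBlowup π D →
        ∀ N : ℕ, topologicalKrullDim ↥X ≤ (N : WithBot ℕ∞) →
          ∀ x' : X', π.base x' ∈ (D.support : Set X) →
            stalkIdeal D (π.base x') = maximalIdeal (X.presheaf.stalk (π.base x')) → CharHypothesis X (π.base x') →
              Scheme.dirDim X (π.base x') = 1 → Scheme.hsFun X' N x' = Scheme.hsFun X N (π.base x') →
                IsIso (π.residueFieldMap x') :=
  Directrix214Sharp.isIso_residueFieldMap_of_near_B4_of_facts h51 HerrmannIkedaOrbanz1988_cor_21_11_holds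

/-- **THE CHARACTERISTIC-2 ROW `stub_Wlow3M_two`: ONE-STATEMENT CENSUS, third edition (2026-08-27, gen 4, F-split discharged).**
`∀ p, p.Prime → Wlow3TwoM p` ⟸ PRINTED {[H4] Th. IV `Hironaka1970_thmIV` (F-51′), CJS Thm. 3.10 (4) `CossartJannsenSaito2020_thm_3_10_4`}
+ OURS CLAIMS R_β {`KeyTheorem640_localized_isolated`, `Corollary637_geomDir`} + OURS CONSTRUCTIONS {`Seg.UnitRecognitionAtQM 2 ⊤`
(stub-1), (c-geo) `StrataLineageInCentreIO`, (K-ctr) `StrataCentreMembersClean` (stub-4 / res-D-pv-038)} (at `p = 2`, level `3`, origins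
`QNe ⊤`, grade `ē ≤ 2`). CONDITIONAL — credits nothing; the row's honest residue as ONE checkable statement.
[cite: CossartJannsenSaito2020, Thm. 3.10 (4), Thm. 3.14, Def. 6.34, Thm. 6.35, Cor. 6.37, Def. 6.38, Thm. 6.40] -/
theorem wlow3TwoM_census₃
    (h51 : Hironaka1970_thmIV.{0}) (h3104 : CossartJannsenSaito2020_thm_3_10_4.{0})
    (hK : KeyTheorem640_localized_isolated.{0}) (hC : Corollary637_geomDir.{0})
    (hrec : Seg.UnitRecognitionAtQM 2 fun _ _ _ _ => True)
    (hgeo : StrataLineageInCentreIO.{0} 2 3 (QNe fun _ _ _ _ => True) fun s => s.geomDirDim ≤ 2)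
    (hKctr : StrataCentreMembersClean.{0} 2 3 (QNe fun _ _ _ _ => True) fun s => s.geomDirDim ≤ 2) :
    ∀ p : ℕ, p.Prime → Wlow3TwoM.{0} p :=
  wlow3TwoM_census₂ h51 HerrmannIkedaOrbanz1988_cor_21_11_holds h3104 hK hC hrec hgeo hKctr

/-- **The strata half of the characteristic row `stub_Wlow3M_char` from F-51′ + (c-geo) + (K-ctr)** (F-split discharged).
[OURS · L1 W4.2; AI-written] [cite: CossartJannsenSaito2020, Thm. 3.14, Thm. 6.35, Rem. 6.29 (1)] -/
theorem wlow3CharStrataM_of_thmIV_centreIO_centreMembersClean {p : ℕ} (h51 : Hironaka1970_thmIV.{0})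
    (hgeo : StrataLineageInCentreIO.{0} p 3 (QNe (Helpers.QCharRegime p)) fun s => s.geomDirDim ≤ 2)
    (hKctr : StrataCentreMembersClean.{0} p 3 (QNe (Helpers.QCharRegime p)) fun s => s.geomDirDim ≤ 2) :
    Wlow3CharStrataM p :=
  wlow3CharStrataM_of_thmIV_split_centreIO_centreMembersClean h51 HerrmannIkedaOrbanz1988_cor_21_11_holds hgeo hKctr

/-- **The regime-free strata row `WlowStrataM p` from F-51′ + (c-geo)⊤ + (K-ctr)⊤** (F-split discharged).
[OURS · L1 W4.2; AI-written] [cite: CossartJannsenSaito2020, Thm. 3.14, Thm. 6.35, Rem. 6.29 (1)] -/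
theorem wlowStrataM_of_thmIV_centreIO_centreMembersClean {p : ℕ} (h51 : Hironaka1970_thmIV.{0})
    (hgeo : StrataLineageInCentreIO.{0} p 3 (QNe fun _ _ _ _ => True) fun s => s.geomDirDim ≤ 2)
    (hKctr : StrataCentreMembersClean.{0} p 3 (QNe fun _ _ _ _ => True) fun s => s.geomDirDim ≤ 2) : WlowStrataM p :=
  wlowStrataM_of_thmIV_split_centreIO_centreMembersClean h51 HerrmannIkedaOrbanz1988_cor_21_11_holds hgeo hKctr

/-! ## (appended 2026-08-27, same seat, #2) The STRATA SOCKETS discharged for every origin predicate — (K-ctr-cv) by res-L1-w42-stub-4's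
## `strataCurveCentreDominantClean_of_geomDir` (11:57Z), Thm. 3.6/3.7 by res-type-064/res-D-lib-1, `ProjDir_projLine` by res-type-031 — census, fourth edition -/

/-- **ROW (K-ctr-cv) at every `Q` modulo F-51′ and CJS Thm. 3.6, BY NAME** (stub-4's `strataCurveCentreDominantClean_of_geomDir` with its
two (F1♯) binders supplied from F-51′ `Hironaka1970_thmIV`). [OURS · L1 W4.2; AI-written] [cite: CossartJannsenSaito2020, Thm. 3.14, Thm. 3.6, Rem. 6.29 (1)] -/
theorem strataCurveCentreDominantClean_of_thmIV {p : ℕ} (h51 : Hironaka1970_thmIV.{u}) (h36 : CossartJannsenSaito2020_thm_3_6.{u})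
    (Q : ℕ → (ℕ → ℕ) → ∀ X : Scheme.{u}, X → Prop) :
    StrataCurveCentreDominantClean.{u} p 3 (QNe Q) fun s => s.geomDirDim ≤ 2 :=
  strataCurveCentreDominantClean_of_geomDir
    (Directrix214Sharp.theorem314_geomDir_of_thmIV_of_split h51 HerrmannIkedaOrbanz1988_cor_21_11_holds)
    (Directrix214Sharp.thm314_point_locus_geomDir_of_thmIV_point (Hironaka1970_thmIV_point_of_thmIV h51)) h36 Q

/-- **(K-ctr-cv) at every `Q` modulo F-51′ ALONE** (F-65 = CJS Thm. 3.6 supplied by the tree theorems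
`CossartJannsenSaito2020_thm_3_6_of_thm_3_7` (res-type-064) and `CossartJannsenSaito2020_thm_3_7_holds` (res-D-lib-1)).
[OURS · L1 W4.2; AI-written] [cite: CossartJannsenSaito2020, Thm. 3.6, Thm. 3.7, Rem. 6.29 (1)] -/
theorem strataCurveCentreDominantClean_of_thmIV' {p : ℕ} (h51 : Hironaka1970_thmIV.{u})
    (Q : ℕ → (ℕ → ℕ) → ∀ X : Scheme.{u}, X → Prop) :
    StrataCurveCentreDominantClean.{u} p 3 (QNe Q) fun s => s.geomDirDim ≤ 2 :=
  strataCurveCentreDominantClean_of_thmIV h51 (CossartJannsenSaito2020_thm_3_6_of_thm_3_7 CossartJannsenSaito2020_thm_3_7_holds) Q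

/-- **KERNEL (K-ctr) `StrataCentreMembersClean p 3 (QNe Q) (ē ≤ 2)` FOR EVERY `Q`, modulo F-51′ `Hironaka1970_thmIV` ALONE**: stub-4's
dispatch `strataCentreMembersClean_of_point_curve_geomDir` fed with its point germ `strataPointCentreMembersClean_of_pointCase_geomDir`
(`ProjDir_projLine_holds`, res-type-031; `Thm314_point_locus_geomDir` from F-51) and the curve germ above. [OURS · L1 W4.2; AI-written]
[cite: CossartJannsenSaito2020, Thm. 3.14, Thm. 3.6, Rem. 6.29 (1)] -/
theorem strataCentreMembersClean_of_thmIV {p : ℕ} (h51 : Hironaka1970_thmIV.{u})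
    (Q : ℕ → (ℕ → ℕ) → ∀ X : Scheme.{u}, X → Prop) :
    StrataCentreMembersClean.{u} p 3 (QNe Q) fun s => s.geomDirDim ≤ 2 :=
  strataCentreMembersClean_of_point_curve_geomDir
    (Directrix214Sharp.theorem314_geomDir_of_thmIV_of_split h51 HerrmannIkedaOrbanz1988_cor_21_11_holds)
    (Directrix214Sharp.theorem314_nearFibre_geomDir_of_facts h51 HerrmannIkedaOrbanz1988_cor_21_11_holds) Q
    (strataPointCentreMembersClean_of_pointCase_geomDir ProjDir_projLine_holds
      (Directrix214Sharp.thm314_point_locus_geomDir_of_thmIV_point (Hironaka1970_thmIV_point_of_thmIV h51)) Q)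
    (strataCurveCentreDominantClean_of_thmIV' h51 Q)

/-- **The regime-free strata row `WlowStrataM p` modulo F-51′ and the (c-geo) kernel at `⊤`.** [OURS · L1 W4.2; AI-written]
[cite: CossartJannsenSaito2020, Thm. 3.14, Thm. 6.35, Rem. 6.29 (1)] -/
theorem wlowStrataM_of_thmIV_centreIO {p : ℕ} (h51 : Hironaka1970_thmIV.{0})
    (hgeo : StrataLineageInCentreIO.{0} p 3 (QNe fun _ _ _ _ => True) fun s => s.geomDirDim ≤ 2) : WlowStrataM p :=
  wlowStrataM_of_thmIV_centreIO_centreMembersClean h51 hgeo (strataCentreMembersClean_of_thmIV h51 _)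

/-- **The regime-free strata row `WlowStrataM p` modulo F-51′ and the printed bundle `LocalChainPrintedFacts`** (stub-4's (c-geo)
composition `strataLineageInCentreIO_of_printedFacts`, p527465). [OURS · L1 W4.2; AI-written]
[cite: CossartJannsenSaito2020, Thm. 3.14, Cor. 6.37, Thm. 6.40, Rem. 6.29 (1)] -/
theorem wlowStrataM_of_thmIV_localChainPrintedFacts {p : ℕ} (h51 : Hironaka1970_thmIV.{0}) (hL : LocalChainPrintedFacts.{0}) :
    WlowStrataM p :=
  wlowStrataM_of_thmIV_centreIO h51 (strataLineageInCentreIO_of_printedFacts hL p _ _)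

/-- **THE CHARACTERISTIC-2 ROW `stub_Wlow3M_two`: ONE-STATEMENT CENSUS, fourth edition (2026-08-27, gen 4) — EVERY STRATA SOCKET
DISCHARGED.** `∀ p, p.Prime → Wlow3TwoM p` ⟸ PRINTED {[H4] Th. IV `Hironaka1970_thmIV` (F-51′), CJS Thm. 3.10 (4)
`CossartJannsenSaito2020_thm_3_10_4`, the bundle `LocalChainPrintedFacts` (res-type-040 p513323) behind stub-4's (c-geo) composition} + OURS
CLAIMS R_β {`KeyTheorem640_localized_isolated`, `Corollary637_geomDir`} + ONE OURS CONSTRUCTION {unit recognition `Seg.UnitRecognitionAtQM 2 ⊤`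
(stub-1)}. The strata kernels (c-geo) (stub-4 p527465), (K-ctr-pt) (stub-4 p526497), (K-ctr-cv) (stub-4, `…CurveDominantCleanGeomDir`),
(K-str) (stub-4 p519120), CJS Thm. 3.6/3.7 (res-type-064 / res-D-lib-1), `ProjDir_projLine` (res-type-031), F-split (res-D-lib-1) and the
three Thm. 3.14 renderings (this seat) are THEOREMS, plugged by name. Same residue as stub-4's `wlow3TwoM_census_printedFacts` with its
h14/h15/h16/hline/hF/hFf/h314pt/h36 binders instantiated. CONDITIONAL — credits nothing.
[cite: CossartJannsenSaito2020, Thm. 3.10 (4), Thm. 3.14, Def. 6.34, Thm. 6.35, Cor. 6.37, Def. 6.38, Thm. 6.40] -/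
theorem wlow3TwoM_census₄
    (h51 : Hironaka1970_thmIV.{0}) (h3104 : CossartJannsenSaito2020_thm_3_10_4.{0}) (hL : LocalChainPrintedFacts.{0})
    (hK : KeyTheorem640_localized_isolated.{0}) (hC : Corollary637_geomDir.{0})
    (hrec : Seg.UnitRecognitionAtQM 2 fun _ _ _ _ => True) :
    ∀ p : ℕ, p.Prime → Wlow3TwoM.{0} p :=
  wlow3TwoM_census₃ h51 h3104 hK hC hrec (strataLineageInCentreIO_of_printedFacts hL 2 _ _)
    (strataCentreMembersClean_of_thmIV h51 _)

/-! ## (appended 2026-08-27, same seat, #3) The bundle `LocalChainPrintedFacts` UNBUNDLED against today's tree — census, fifth edition: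
## TWO printed facts, TWO OURS claims, ONE OURS construction -/

/-- Universe-polymorphic form of `keyTheorem640_char_localized_isolated_of_free` (p520092, stated at universe `0`): the OURS claim
`KeyTheorem640_localized_isolated` implies the printed F-04c carrier (drop the characteristic hypothesis). [folklore; AI-written] -/
theorem keyTheorem640_char_localized_isolated_of_free' (h : KeyTheorem640_localized_isolated.{u}) :
    KeyTheorem640_char_localized_isolated.{u} :=
  fun T N len pt tpt hset _ hchain hiso => h T N len pt tpt hset hchain hiso

/-- **The printed bundle `LocalChainPrintedFacts` (res-type-040, rev 2: Cor. 6.37 loc (F1), Thm. 6.40 loc-iso (F1), Thm. 3.14 num,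
Thm. 3.10 (4), Kollár 1.101, Thm. 3.14 point locus) from F-51′, CJS Thm. 3.10 (4) and the two R_β claims**: Kollár 1.101 is a tree
theorem (`Kollar2007_thm_1_101_localChain_holds`, res-L1-w42-stub-3 g2 / librarians), both Thm. 3.14 renderings follow from F-51′
(`cossartJannsenSaito2020_thm_3_14_of_thmIV_of_split`, res-type-031's `Directrix214Sharp.thm314_point_locus_of_thmIV`), and the two (F1)
key theorems are IMPLIED by the characteristic-free R_β claims (`corollary637_char_of_geomDir` + `Corollary637_char.toLoc`,
`keyTheorem640_char_localized_isolated_of_free`). [OURS · L1 W4.2; AI-written]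
[cite: CossartJannsenSaito2020, Cor. 6.37, Thm. 6.40, Thm. 3.14, Thm. 3.10 (4); Kollar2007, Thm. 1.101] -/
theorem localChainPrintedFacts_of_thmIV_of_claims (h51 : Hironaka1970_thmIV.{u}) (h3104 : CossartJannsenSaito2020_thm_3_10_4.{u})
    (hK : KeyTheorem640_localized_isolated.{u}) (hC : Corollary637_geomDir.{u}) : LocalChainPrintedFacts.{u} :=
  ⟨(corollary637_char_of_geomDir hC).toLoc, keyTheorem640_char_localized_isolated_of_free' hK,
    cossartJannsenSaito2020_thm_3_14_of_thmIV_of_split h51 HerrmannIkedaOrbanz1988_cor_21_11_holds, h3104,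
    Kollar2007_thm_1_101_localChain_holds, Directrix214Sharp.thm314_point_locus_of_thmIV h51⟩

/-- **THE CHARACTERISTIC-2 ROW `stub_Wlow3M_two`: ONE-STATEMENT CENSUS, fifth edition (2026-08-27, gen 4).**
`∀ p, p.Prime → Wlow3TwoM p` ⟸ exactly: PRINTED {[H4] Th. IV `Hironaka1970_thmIV` (F-51′), CJS Thm. 3.10 (4) `CossartJannsenSaito2020_thm_3_10_4`}
+ OURS CLAIMS R_β {`KeyTheorem640_localized_isolated` (CJS Thm. 6.40, localised, isolated, characteristic-free), `Corollary637_geomDir`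
(CJS Cor. 6.37 under (F1♯))} + ONE OURS CONSTRUCTION {unit recognition `Seg.UnitRecognitionAtQM 2 ⊤` (res-L1-w42-stub-1)}. Everything else
the row ever consumed — F-split, Thm. 3.6/3.7, the three Thm. 3.14 renderings, `ProjDir_line`, `ProjDir_projLine`, F14–F16, Kollár 1.101,
(c-geo), (K-ctr-pt), (K-ctr-cv), (K-str), (b-fib), (b-curve) — is a tree theorem plugged by name. CONDITIONAL — credits nothing; the
row's honest residue as ONE checkable statement. [cite: CossartJannsenSaito2020, Thm. 3.10 (4), Thm. 3.14, Def. 6.34, Thm. 6.35, Cor. 6.37, Def. 6.38, Thm. 6.40]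
[cite: Hironaka1970NumericalCharacters, Th. IV] -/
theorem wlow3TwoM_census₅
    (h51 : Hironaka1970_thmIV.{0}) (h3104 : CossartJannsenSaito2020_thm_3_10_4.{0})
    (hK : KeyTheorem640_localized_isolated.{0}) (hC : Corollary637_geomDir.{0})
    (hrec : Seg.UnitRecognitionAtQM 2 fun _ _ _ _ => True) :
    ∀ p : ℕ, p.Prime → Wlow3TwoM.{0} p :=
  wlow3TwoM_census₄ h51 h3104 (localChainPrintedFacts_of_thmIV_of_claims h51 h3104 hK hC) hK hC hrec

/-- **The regime-free strata row `WlowStrataM p` (every prime, every origin) from F-51′, CJS Thm. 3.10 (4) and the two R_β claims** — no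
construction left on the strata side. [OURS · L1 W4.2; AI-written] [cite: CossartJannsenSaito2020, Thm. 3.14, Cor. 6.37, Thm. 6.40, Rem. 6.29 (1)] -/
theorem wlowStrataM_of_thmIV_of_claims {p : ℕ} (h51 : Hironaka1970_thmIV.{0}) (h3104 : CossartJannsenSaito2020_thm_3_10_4.{0})
    (hK : KeyTheorem640_localized_isolated.{0}) (hC : Corollary637_geomDir.{0}) : WlowStrataM p :=
  wlowStrataM_of_thmIV_localChainPrintedFacts h51 (localChainPrintedFacts_of_thmIV_of_claims h51 h3104 hK hC)

end Summit.ResolutionOfSingularities.ResolutionOfSingularities.Theorems.SigmaMaxModificationsCorridor3.Moving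

end
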